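import Literature.NumberTheory.LFunctions.Zhang2022.Section8Lemma84Poles
import HarnessLib

/-!
# Zhang (2022), Lemma 10.2 — the singularities of the Perron integrand at shift `β_μ = 0` inside
# the contour, and the passage from the big rectangle to the small one

Topic `Literature/NumberTheory/LFunctions/Zhang2022` (Landau–Siegel audit tree; verdict-neutral).
Y. Zhang, *Discrete mean estimates and the Landau–Siegel zero*, arXiv:2211.02515v1 (2022)
[Zhang2022LandauSiegel] — **an unrefereed manuscript under adjudication**; DAG nodes `Z22:Lem10.2.pf`,
`Z22:§10.u019/u021/u022` [Z22 p.56, tex L2824–L2851] ("In view of (8.9) and (10.6) … The contour of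
integration is moved in the same way as the proof of Lemma 8.1").

This is the `β_μ = 0` companion of `Section8Lemma84Poles` (sz-d27): after the tent decomposition of
`f̃`, the sum `𝔳₂ⱼ(d,r)` of Lemma 10.2 is a combination of the UNTWISTED log-weighted sums
`Σ_{n<x} χ(n)ξ₀ⱼ(n;d,r)n⁻¹log(x/n)`, whose Perron integrand in the variable `u` is
`G(u) = e^{uL}Φ(u)/u²`, `Φ(u) = 𝔲_j(d,r;1+u)L(1+u+β_a,χ)L(1+u+β_b,χ)/L(1+u,χ)`. Inside the contour
`G` has exactly two singularities, BOTH ON THE REAL AXIS: the double pole `u = 0` of the kernel and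
the simple pole `u₁ = ρ̃ − 1 < 0` from the exceptional zero `ρ̃` of `L(s,χ)` (Lemma 5.5). For an
ARBITRARY continuation `U`, character `χ ≠ χ₀`, shifts `β_a, β_b` and a real simple zero `ρ < 1` of
`L(·,χ)` that is its only zero in the box `Re w > 1 − 2η`, `|Im w| < T + 1`:

* `exists_rect_value0` — the residue theorem gives ONE value `R = 2πi(Res₀ + Res_{u₁})` for every
  admissible rectangle (contained in the box, containing `0` and `u₁` in its interior);
* `rect_big_eq_rect_small0` — **`∮_{∂([−η,α]×[−T,T])} G = ∮_{∂([−α/2,α/2]×[−3α,3α])} G`**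
  (`1 − α/2 < ρ`), so the residues are never computed: the small rectangle is then compared with the
  model `Section10Lemma102Model` pointwise.

Nothing about the manuscript's Theorems 1–2 or about Landau–Siegel zeros is asserted.

## References

* Y. Zhang, arXiv:2211.02515v1 (2022), §10 Lemma 10.2 (proof); §8 (8.9), Lemma 8.3; Lemma 5.5.
  [cite: Zhang2022LandauSiegel, §10 Lemma 10.2]
* J. B. Conway, *Functions of One Complex Variable I*, GTM 11, Ch. V §2 Thm 2.2. [cite: Conway1978, V.2.2]
-/

noncomputable section

open Complex Real Set Filter Topology

namespace Literature.NumberTheory.LFunctions.Zhang2022.Lemma102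

open Literature.Analysis.Complex
open Literature.NumberTheory.LFunctions.Zhang2022.Lemma84 (differentiableAt_Phi differentiableAt_G)

section Poles

variable {D : ℕ} [NeZero D] (χ : DirichletCharacter ℂ D)
variable (U Φ G : ℂ → ℂ) (βa βb : ℂ) (Ly : ℂ) (ρ η α T : ℝ)

/-- Factoring a simple zero: `f(u) = (u − a)ψ(u)` with `ψ` entire and `ψ(a) = f′(a)` (Mathlib's
`dslope`). [folklore] -/
private theorem exists_factor_of_zero (f : ℂ → ℂ) (hf : Differentiable ℂ f) (a : ℂ) (hfa : f a = 0) :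
    ∃ ψ : ℂ → ℂ, Differentiable ℂ ψ ∧ ψ a = deriv f a ∧ ∀ u, f u = (u - a) * ψ u := by
  refine ⟨dslope f a, ?_, dslope_same f a, fun u => ?_⟩
  · have h : DifferentiableOn ℂ (dslope f a) Set.univ := by
      rw [differentiableOn_dslope (Filter.univ_mem)]
      exact hf.differentiableOn
    exact fun u => h.differentiableAt (Filter.univ_mem)
  · have h := sub_smul_dslope f a u
    rw [smul_eq_mul, hfa, sub_zero] at h
    exact h.symm

/-- The hypothesis `Φ(u) = U(1+u)L(1+u+β_a)L(1+u+β_b)/L(1+u)` in the form consumed by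
`Section8Lemma84Poles` (shift `β_μ = 0`). [folklore] -/
private theorem hPhi_shift0
    (hΦ : ∀ u, Φ u = U (1 + u) * χ.LFunction (1 + u + βa) * χ.LFunction (1 + u + βb) /
      χ.LFunction (1 + u)) :
    ∀ u, Φ u = U (1 - 0 + u) * χ.LFunction (1 - 0 + u + βa) * χ.LFunction (1 - 0 + u + βb) /
      χ.LFunction (1 - 0 + u) := by
  intro u; rw [sub_zero]; exact hΦ u

/-- The numerator at the simple pole is holomorphic where `ψ ≠ 0`, `u ≠ 0`. [folklore] -/
private theorem differentiableAt_num1 (hχ1 : χ ≠ 1)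
    (hUd : DifferentiableOn ℂ U {s : ℂ | 9 / 10 < s.re})
    (ψ : ℂ → ℂ) (hψ : Differentiable ℂ ψ) {u : ℂ} (hre : -(1 / 10 : ℝ) < u.re) (hu0 : u ≠ 0)
    (hψu : ψ u ≠ 0) :
    DifferentiableAt ℂ (fun u : ℂ => cexp (u * Ly) * (U (1 + u) *
      χ.LFunction (1 + u + βa) * χ.LFunction (1 + u + βb)) / (u ^ 2 * ψ u)) u := by
  have hLd := DirichletCharacter.differentiable_LFunction hχ1
  have hre' : 9 / 10 < (1 + u).re := by
    simp only [add_re, one_re]; linarith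
  have hopen : IsOpen {s : ℂ | 9 / 10 < s.re} := isOpen_lt continuous_const Complex.continuous_re
  have hw : DifferentiableAt ℂ (fun u : ℂ => 1 + u) u := differentiableAt_id.const_add _
  have hUu : DifferentiableAt ℂ (fun u : ℂ => U (1 + u)) u :=
    (hUd.differentiableAt (hopen.mem_nhds hre')).comp u hw
  have h1 : DifferentiableAt ℂ (fun u : ℂ => χ.LFunction (1 + u + βa)) u :=
    (hLd _).comp u (hw.add_const _)
  have h2 : DifferentiableAt ℂ (fun u : ℂ => χ.LFunction (1 + u + βb)) u :=
    (hLd _).comp u (hw.add_const _)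
  have hnum : DifferentiableAt ℂ (fun u : ℂ => cexp (u * Ly) * (U (1 + u) *
      χ.LFunction (1 + u + βa) * χ.LFunction (1 + u + βb))) u :=
    ((differentiableAt_id.mul_const _).cexp).mul ((hUu.mul h1).mul h2)
  exact hnum.div ((differentiableAt_id.pow 2).mul (hψ u)) (mul_ne_zero (pow_ne_zero 2 hu0) hψu)

/-- `G = N₁/(u − u₁)` off `u₁` when `L(1+u) = (u − u₁)ψ(u)`. [folklore] -/
private theorem G_eq_num1_div
    (hΦ : ∀ u, Φ u = U (1 + u) * χ.LFunction (1 + u + βa) *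
      χ.LFunction (1 + u + βb) / χ.LFunction (1 + u))
    (hG : ∀ u, G u = cexp (u * Ly) * Φ u / u ^ 2) (ψ : ℂ → ℂ) {u₁ z : ℂ}
    (hfac : χ.LFunction (1 + z) = (z - u₁) * ψ z) (hz0 : z ≠ 0) (hzu : z ≠ u₁)
    (hψz : ψ z ≠ 0) :
    G z = (cexp (z * Ly) * (U (1 + z) * χ.LFunction (1 + z + βa) *
      χ.LFunction (1 + z + βb)) / (z ^ 2 * ψ z)) / (z - u₁) ^ (0 + 1) := by
  have hzu' : z - u₁ ≠ 0 := sub_ne_zero.2 hzu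
  have hz2 : z ^ 2 ≠ 0 := pow_ne_zero 2 hz0
  rw [hG z, hΦ z, zero_add, pow_one, hfac]
  field_simp

/-- The only zero of `L(1 + u)` in the box `−2η < Re u < 1`, `|Im u| < T + 1/2` is `u₁ = ρ − 1`.
[cite: Zhang2022LandauSiegel, §5 Lemma 5.5] -/
private theorem LFunction_ne_zero_of_box0
    (hzf : ∀ w : ℂ, 1 - 2 * η < w.re → |w.im| < T + 1 → w ≠ ρ → χ.LFunction w ≠ 0)
    {u : ℂ} (hu : u ∈ {u : ℂ | -(2 * η) < u.re ∧ u.re < 1 ∧ |u.im| < T + 1 / 2})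
    (hne : u ≠ ((ρ - 1 : ℝ) : ℂ)) : χ.LFunction (1 + u) ≠ 0 := by
  have hu' : -(2 * η) < u.re ∧ u.re < 1 ∧ |u.im| < T + 1 / 2 := hu
  have hw : (1 + u) ≠ (ρ : ℂ) := by
    intro h; apply hne
    have : u = (ρ : ℂ) - 1 := by rw [← h]; ring
    rw [this]; push_cast; ring
  refine hzf (1 + u) ?_ ?_ hw
  · simp only [add_re, one_re]; linarith [hu'.1]
  · have : (1 + u).im = u.im := by simp
    rw [this]; linarith [hu'.2.2]

/-- **The residue value is the same for every admissible rectangle** (shift `0`): there is `R ∈ ℂ`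
(`= 2πi(Res₀ + Res_{u₁})`) with `∮_{∂([a,b]×[c,d])} G = R` whenever the closed rectangle lies in the
box `−2η < Re u < 1`, `|Im u| < T + 1/2` and contains `0` and `u₁ = ρ − 1` in its interior.
[cite: Zhang2022LandauSiegel, §10 Lemma 10.2 (proof)] [cite: Conway1978, V.2.2] -/
theorem exists_rect_value0 (hχ1 : χ ≠ 1) (hUd : DifferentiableOn ℂ U {s : ℂ | 9 / 10 < s.re})
    (hΦ : ∀ u, Φ u = U (1 + u) * χ.LFunction (1 + u + βa) *
      χ.LFunction (1 + u + βb) / χ.LFunction (1 + u))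
    (hG : ∀ u, G u = cexp (u * Ly) * Φ u / u ^ 2) (hη : η ≤ 1 / 40) (hT : 1 ≤ T)
    (hρ1 : ρ < 1) (hρη : 1 - 2 * η < ρ) (hLρ : χ.LFunction ρ = 0)
    (hL'ρ : deriv χ.LFunction ρ ≠ 0)
    (hzf : ∀ w : ℂ, 1 - 2 * η < w.re → |w.im| < T + 1 → w ≠ ρ → χ.LFunction w ≠ 0) :
    ∃ R : ℂ, ∀ a b c d : ℝ, a < b → c < d →
      Icc a b ×ℂ Icc c d ⊆ {u : ℂ | -(2 * η) < u.re ∧ u.re < 1 ∧ |u.im| < T + 1 / 2} →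
      (0 : ℂ) ∈ Ioo a b ×ℂ Ioo c d → (((ρ - 1 : ℝ) : ℂ)) ∈ Ioo a b ×ℂ Ioo c d →
      rectBoundaryIntegral G a b c d = R := by
  classical
  have hΦ0 := hPhi_shift0 χ U Φ βa βb hΦ
  -- the pole `u₁`
  set u₁ : ℂ := ((ρ - 1 : ℝ) : ℂ) with hu₁
  have hu₁re : u₁.re = ρ - 1 := by simp [hu₁]
  have hu₁im : u₁.im = 0 := by simp [hu₁]
  have hw₁ : 1 + u₁ = ρ := by rw [hu₁]; push_cast; ring
  have hu₁0 : u₁ ≠ 0 := by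
    intro h; have := congrArg Complex.re h; rw [hu₁re] at this; simp at this; linarith
  -- the open box
  set Uo : Set ℂ := {u : ℂ | -(2 * η) < u.re ∧ u.re < 1 ∧ |u.im| < T + 1 / 2} with hUo
  have hUo_open : IsOpen Uo := by
    have h1 : IsOpen {u : ℂ | -(2 * η) < u.re} := isOpen_lt continuous_const Complex.continuous_re
    have h2 : IsOpen {u : ℂ | u.re < 1} := isOpen_lt Complex.continuous_re continuous_const
    have h3 : IsOpen {u : ℂ | |u.im| < T + 1 / 2} :=
      isOpen_lt (continuous_abs.comp Complex.continuous_im) continuous_const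
    have : Uo = {u : ℂ | -(2 * η) < u.re} ∩ ({u : ℂ | u.re < 1} ∩ {u : ℂ | |u.im| < T + 1 / 2}) := by
      ext u; rfl
    rw [this]; exact h1.inter (h2.inter h3)
  have hLne : ∀ u ∈ Uo, u ≠ u₁ → χ.LFunction (1 + u) ≠ 0 := fun u hu hne =>
    LFunction_ne_zero_of_box0 χ ρ η T hzf hu hne
  have hLne' : ∀ u ∈ Uo, u ≠ u₁ → χ.LFunction (1 - 0 + u) ≠ 0 := fun u hu hne => by
    rw [sub_zero]; exact hLne u hu hne
  -- `L(1+u) = (u − u₁) ψ(u)` with `ψ` entire, `ψ(u₁) = L′(ρ) ≠ 0`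
  have hLd := DirichletCharacter.differentiable_LFunction hχ1
  have hLw_diff : Differentiable ℂ (fun u : ℂ => χ.LFunction (1 + u)) :=
    fun u => (hLd _).comp u (differentiableAt_id.const_add _)
  have hLw_u₁ : (fun u : ℂ => χ.LFunction (1 + u)) u₁ = 0 := by
    show χ.LFunction (1 + u₁) = 0
    rw [hw₁, hLρ]
  obtain ⟨ψ, hψ_diff, hψ_u₁', hfac⟩ :=
    exists_factor_of_zero (fun u : ℂ => χ.LFunction (1 + u)) hLw_diff u₁ hLw_u₁
  have hψ_u₁ : ψ u₁ = deriv χ.LFunction ρ := by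
    rw [hψ_u₁']
    have hg : HasDerivAt (fun u : ℂ => 1 + u) 1 u₁ := (hasDerivAt_id u₁).const_add 1
    have h := ((hLd (1 + u₁)).hasDerivAt).comp u₁ hg
    rw [hw₁, mul_one] at h
    exact h.deriv
  -- neighbourhood of `u₁` where `ψ ≠ 0`, `u ≠ 0`, inside `Uo`
  set V₁ : Set ℂ := Uo ∩ {u : ℂ | ψ u ≠ 0} ∩ {u : ℂ | u ≠ 0} with hV₁
  have hV₁_open : IsOpen V₁ :=
    (hUo_open.inter (isOpen_ne_fun hψ_diff.continuous continuous_const)).inter isOpen_ne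
  have hu₁Uo : u₁ ∈ Uo := by
    refine ⟨?_, ?_, ?_⟩
    · rw [hu₁re]; linarith
    · rw [hu₁re]; linarith
    · rw [hu₁im, abs_zero]; linarith
  have hu₁V₁ : u₁ ∈ V₁ := ⟨⟨hu₁Uo, by simp only [mem_setOf_eq, hψ_u₁]; exact hL'ρ⟩, hu₁0⟩
  have h0Uo : (0 : ℂ) ∈ Uo := by
    refine ⟨?_, ?_, ?_⟩
    · simp only [Complex.zero_re]; linarith
    · simp only [Complex.zero_re]; linarith
    · simp only [Complex.zero_im, abs_zero]; linarith
  -- pole data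
  set S : Finset ℂ := {0, u₁} with hS
  set n : ℂ → ℕ := fun p => if p = 0 then 1 else 0 with hn
  set N₁ : ℂ → ℂ := fun u => cexp (u * Ly) * (U (1 + u) * χ.LFunction (1 + u + βa) *
      χ.LFunction (1 + u + βb)) / (u ^ 2 * ψ u) with hN₁
  set φ : ℂ → ℂ → ℂ := fun p => if p = 0 then (fun u => cexp (u * Ly) * Φ u) else N₁ with hφ
  have hφ0 : φ 0 = fun u => cexp (u * Ly) * Φ u := by rw [hφ]; exact if_pos rfl
  have hφ1 : φ u₁ = N₁ := by rw [hφ]; exact if_neg hu₁0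
  have hn0 : n 0 = 1 := by rw [hn]; exact if_pos rfl
  have hn1 : n u₁ = 0 := by rw [hn]; exact if_neg hu₁0
  have hpole : ∀ p ∈ S, ∃ V ∈ 𝓝 p, DifferentiableOn ℂ (φ p) V ∧
      ∀ z ∈ V, z ≠ p → G z = φ p z / (z - p) ^ (n p + 1) := by
    intro p hp
    simp only [hS, Finset.mem_insert, Finset.mem_singleton] at hp
    rcases hp with hp | hp
    · rw [hp, hφ0, hn0]
      refine ⟨Uo ∩ {u | u ≠ u₁}, (hUo_open.inter isOpen_ne).mem_nhds ⟨h0Uo, Ne.symm hu₁0⟩, ?_, ?_⟩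
      · intro u hu
        have hu1 : u ∈ Uo := hu.1
        have hu' : -(2 * η) < u.re ∧ u.re < 1 ∧ |u.im| < T + 1 / 2 := hu1
        have hre : -(1 / 10 : ℝ) < u.re := by linarith [hu'.1]
        have hd := differentiableAt_Phi χ U Φ 0 βa βb hχ1 hUd (by simp) hΦ0 hre (hLne' u hu1 hu.2)
        exact (((differentiableAt_id.mul_const _).cexp).mul hd).differentiableWithinAt
      · intro z _ hz0
        rw [sub_zero, hG z]
    · rw [hp, hφ1, hn1]
      refine ⟨V₁, hV₁_open.mem_nhds hu₁V₁, ?_, ?_⟩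
      · intro u hu
        have hu' : -(2 * η) < u.re ∧ u.re < 1 ∧ |u.im| < T + 1 / 2 := hu.1.1
        have hre : -(1 / 10 : ℝ) < u.re := by linarith [hu'.1]
        exact (differentiableAt_num1 χ U βa βb Ly hχ1 hUd ψ hψ_diff hre hu.2
          hu.1.2).differentiableWithinAt
      · intro z hz hzu
        exact G_eq_num1_div χ U Φ G βa βb Ly hΦ hG ψ (hfac z) hz.2 hzu hz.1.2
  refine ⟨2 * Real.pi * I * ∑ p ∈ S, (Function.swap dslope p)^[n p] (φ p) p,
    fun a b c d hab hcd hK h0 h1 => ?_⟩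
  have hS' : (S : Set ℂ) ⊆ Ioo a b ×ℂ Ioo c d := by
    intro p hp
    simp only [hS, Finset.coe_insert, Finset.coe_singleton, Set.mem_insert_iff,
      Set.mem_singleton_iff] at hp
    rcases hp with hp | hp <;> rw [hp]
    · exact h0
    · exact h1
  have hF : DifferentiableOn ℂ G (Uo \ ↑S) := by
    intro u hu
    have hu' : u ∉ (S : Set ℂ) := hu.2
    simp only [hS, Finset.coe_insert, Finset.coe_singleton, Set.mem_insert_iff,
      Set.mem_singleton_iff, not_or] at hu'
    have hu1 : u ∈ Uo := hu.1
    have hu'' : -(2 * η) < u.re ∧ u.re < 1 ∧ |u.im| < T + 1 / 2 := hu1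
    have hre : -(1 / 10 : ℝ) < u.re := by linarith [hu''.1]
    exact (differentiableAt_G Φ G Ly hG
      (differentiableAt_Phi χ U Φ 0 βa βb hχ1 hUd (by simp) hΦ0 hre (hLne' u hu1 hu'.2)) hu'.1)
      |>.differentiableWithinAt
  exact rectBoundaryIntegral_eq_sum_of_poles hab hcd S G n φ Uo hUo_open hK hS' hF hpole

/-- **The two rectangles have the same boundary integral** (shift `0`). Hypotheses: `χ ≠ χ₀`; `U`
holomorphic on `σ > 9/10`; `α ≤ η ≤ 1/40`, `1 ≤ T`; `ρ` a real zero of `L(·,χ)` with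
`L′(ρ,χ) ≠ 0`, `1 − α/2 < ρ < 1`, which is the only zero of `L(·,χ)` with `Re w > 1 − 2η`,
`|Im w| < T + 1`. Then for `G(u) = e^{uL}Φ(u)/u²`,
`∮_{∂([−η,α]×[−T,T])} G = ∮_{∂([−α/2,α/2]×[−3α,3α])} G`: both rectangles contain the poles `0` and
`u₁ = ρ − 1` and no other singularity. [cite: Zhang2022LandauSiegel, §10 Lemma 10.2 (proof)]
[cite: Conway1978, V.2.2] -/
theorem rect_big_eq_rect_small0 (hχ1 : χ ≠ 1) (hUd : DifferentiableOn ℂ U {s : ℂ | 9 / 10 < s.re})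
    (hΦ : ∀ u, Φ u = U (1 + u) * χ.LFunction (1 + u + βa) *
      χ.LFunction (1 + u + βb) / χ.LFunction (1 + u))
    (hG : ∀ u, G u = cexp (u * Ly) * Φ u / u ^ 2)
    (hαη : α ≤ η) (hη : η ≤ 1 / 40) (hT : 1 ≤ T)
    (hρ1 : ρ < 1) (hρα : 1 - α / 2 < ρ) (hLρ : χ.LFunction ρ = 0) (hL'ρ : deriv χ.LFunction ρ ≠ 0)
    (hzf : ∀ w : ℂ, 1 - 2 * η < w.re → |w.im| < T + 1 → w ≠ ρ → χ.LFunction w ≠ 0) :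
    rectBoundaryIntegral G (-η) α (-T) T =
      rectBoundaryIntegral G (-(α / 2)) (α / 2) (-(3 * α)) (3 * α) := by
  have hρη : 1 - 2 * η < ρ := by linarith
  obtain ⟨R, hR⟩ := exists_rect_value0 χ U Φ G βa βb Ly ρ η T hχ1 hUd hΦ hG hη hT hρ1 hρη hLρ
    hL'ρ hzf
  have hu₁re : (((ρ - 1 : ℝ) : ℂ)).re = ρ - 1 := by simp
  have hu₁im : (((ρ - 1 : ℝ) : ℂ)).im = 0 := by simp
  have hbig := hR (-η) α (-T) T (by linarith) (by linarith)
    (by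
      intro u hu
      obtain ⟨⟨h1, h2⟩, h3, h4⟩ := hu
      exact ⟨by linarith, by linarith, by rw [abs_lt]; constructor <;> linarith⟩)
    (by
      refine ⟨⟨?_, ?_⟩, ?_, ?_⟩ <;> simp only [Complex.zero_re, Complex.zero_im] <;> linarith)
    (by
      refine ⟨⟨?_, ?_⟩, ?_, ?_⟩
      · rw [hu₁re]; linarith
      · rw [hu₁re]; linarith
      · rw [hu₁im]; linarith
      · rw [hu₁im]; linarith)
  have hsmall := hR (-(α / 2)) (α / 2) (-(3 * α)) (3 * α) (by linarith) (by linarith)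
    (by
      intro u hu
      obtain ⟨⟨h1, h2⟩, h3, h4⟩ := hu
      exact ⟨by linarith, by linarith, by rw [abs_lt]; constructor <;> linarith⟩)
    (by
      refine ⟨⟨?_, ?_⟩, ?_, ?_⟩ <;> simp only [Complex.zero_re, Complex.zero_im] <;> linarith)
    (by
      refine ⟨⟨?_, ?_⟩, ?_, ?_⟩
      · rw [hu₁re]; linarith
      · rw [hu₁re]; linarith
      · rw [hu₁im]; linarith
      · rw [hu₁im]; linarith)
  rw [hbig, hsmall]

end Poles

end Literature.NumberTheory.LFunctions.Zhang2022.Lemma102
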